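/-
Copyright (c) 2026 the pub-hodgecm-mathlib formalisation cell (harness21).  Prover seat hodgecm-mathlib-K2E1-p12 (g4), Track B «K2-LIT» ∕ R90-TF section S5;
BY-NAME DEAL #20 of the S5 dealer R90-C133-plan (g0) (`R90/STATUS.md` 2026-09-04T16:36:33Z (4)).  2026-09-04.
-/
import Summits.HodgeConjecture.HodgeConjecture.Theorems.F0P3SpectralPacketXi              -- ★ (N) FILE 3e: `GlobalPacketH.rhoXi h8 ξ` (+ `rhoXi_isCharPacket`, `memH_rhoXi_loc`, `eq_rhoXi_of_isCharPacket`; brings ★ 3c `IsCharPacket`, ★ 1c `OneDimHLaw`)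
import Summits.HodgeConjecture.HodgeConjecture.Theorems.F0P3cPKtupleKR2OfKD4H            -- ★ LH7 (γ′) estate: `boxChar_eq_mk_xiLocalChar`; brings ★ `F0P3cPKtupleU1Line` (`realises₂_ofChar`, `realises₁_ofChar`, `isAutomorphic_eta_mul_psi`), ★ `…HSideLetters`, ★ 3g `SpectralPacketH`
import Summits.HodgeConjecture.HodgeConjecture.Theorems.R90S5HasFinComponentOfDiscrete     -- ★ p861944 (this seat): `exists_irreducible_admissible_hasFinComponent_of_isCompactOperator` (no «AFA» for the character lines)
import Summits.HodgeConjecture.HodgeConjecture.Theorems.F0P3FinPartConstituentTransfer     -- ★ `smoothConstituents_iff_of_hasFinComponent`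
import Summits.HodgeConjecture.HodgeConjecture.Theorems.F0P3GlobalPacketDiscrete           -- ★ `cmOccursInDiscreteSpectrum`, `exists_cmOccursInDiscreteSpectrum_of_hasFinComponent`
import Mathlib.Analysis.Normed.Operator.Compact.Basic
import HarnessLib

/-!
# R90-TF · S5 — DEAL #20 (G2): the SPECTRAL `H`-PACKET OF A ONE-DIMENSIONAL AUTOMORPHIC `ξ` of `H = U(Φ₂) × U(Φ₁)` — constructor, `IsOneDimH`, and the discharge of its
# discreteness at the record's shape (`Theorems/R90S5SpectralPacketHOfOneDim.lean`; seat K2E1-p12 (g4); census `R90/S5/K2E1-p12/CENSUS-PacketHOfOneDim.md`)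

Cell `hodgecm-mathlib`, crux H413 (`stmt-HodgeConjecture-24833`), route of record `HCCMUnconditional`; programme R90-TF, section S5 (Rogawski Ch. 13.3), junction J3-R5 (F5)
(S5-C `PacketHOfRecord` needs a NAMED constructor `packetHOfOneDim : OneDimAutRepH L → PacketHOfRecord …` and `IsOneDimH`).  DEFINITION lane (four `def`s WITH BODY +
theorems); `--supports stmt-HodgeConjecture-24833 --as helper`.  No instance, no notation, no named fact, no `sorry`.  L9: NO `Lines` import — S5-C's `IsRealisedH` ∕ `discHOfRecord`
(`Cruxes/H413/Lines/R90_S5_HSideExportC.lean` :95 ∕ :112) are met by their UNFOLDED bodies, token for token, with `DiscH`, `archH`, `μ₂`, `μ₁` as parameters; K2E1-typ1's C ED. 5 ties by `Iff.rfl`.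

PRINT.  `ξ = (η, ψ)` is the one-dimensional automorphic representation `h ↦ η(det₀ h) ψ(det h)` of `H(𝔸) = U(2) × U(1)` [Rogawski1990 §13.3 p. 202]; as a representation of
`H = U(Φ₂) × U(Φ₁)` it is `((η ψ) ∘ det₀) ⊠ ψ` (★ `xiLocalChar_apply_eq`, ★ `xiLocalChar_comp_inl` ∕ `_inr`).  Its local components are singleton L-packets of `H_v` [§12.1 type (3);
§13.1 p. 199], and `ξ` is DISCRETE: the line `ℂ · ((η ψ) ∘ det₀)⁻¹` of `L²_disc(U(Φ₂))` and the line `ℂ · (ψ ∘ det)⁻¹` of `L²(U(Φ₁))` realise it [§13.3 p. 203 «`n(ξ) = 1`»;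
BorelJacquet1979 §4.6; Gelbart1975 §2.A].

CONTENTS.
* §1 **`spectralPacketHOfOneDim h8 ξ Pinf hunr hdisc : SpectralPacketH 𝔩 𝔞 𝔞H DiscH`** := `⟨rhoXi h8 ξ, Pinf, hunr, hdisc⟩` — the finite part IS ★ `GlobalPacketH.rhoXi h8 ξ` (the singletons
  `{⟦ξ_v⟧}` under (ℓ8) ★ `OneDimHLaw`); `Pinf : 𝔞H.PktInfH` is a PARAMETER (the abstract archimedean datum ★ `ArchPacketKitH` has no character slot — at the record
  `Pinf := archH (piTwoOfOneDim ξ) (chiOneOfOneDim ξ)`, §3); `hunr` («`ξ_H(ξ_v)` has an unramified member a.e.», a fact about the kit's `xiH`∕`unr` data) is THE one binder besides `h8`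
  (also in IMAGE form `spectralPacketHOfOneDimOfImage … (Pg : GlobalPacket 𝔩) (himg : Pg.IsImageOf (rhoXi h8 ξ))`, the pattern of ★ `F0P3SpectralPacketNValueOfRigidityH` :196);
  `rfl` read-backs.  **`IsOneDimH ρ :↔ ∃ ξ, ρ.fin.IsCharPacket (ξ_v)_v`** (kit-law-free, the first conjunct of ★ `XiHPacketsSigned`), `↔ ∃ ξ, ρ.fin = rhoXi h8 ξ` under (ℓ8),
  `↔ ∃ ξ hunr hdisc, ρ = spectralPacketHOfOneDim h8 ξ ρ.inf hunr hdisc` (the dealer's shape), `isOneDimH_spectralPacketHOfOneDim`.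
* §2 THE EXPLICIT REALISING PAIR of `ξ`: **`piTwoOfOneDim ξ v := ⟦ℂ_{ξ_v ∘ inl}⟧`** (`= ⟦(η_v ψ_v) ∘ det₀⟧`), **`chiOneOfOneDim ξ v := ξ_v ∘ inr`** (`= ψ_v ∘ det`), with
  **`cmOccursInDiscreteSpectrum L 2 Φ₂ μ₂ (piTwoOfOneDim ξ)`** and **`cmOccursInDiscreteSpectrum L 1 Φ₁ μ₁ (⟦ℂ_{chiOneOfOneDim ξ v}⟧)_v`** for EVERY automorphic measures `μ₂, μ₁` — witnesses
  the ★ character lines `DiscreteAutomorphicRep.ofChar (cmDetChar L 2 Φ₂ (η ψ) …)⁻¹ μ₂` ∕ `… (cmDetChar L 1 Φ₁ ψ …)⁻¹ μ₁` (★ `realises₂_ofChar`, ★ `realises₁_ofChar`), their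
  irreducible admissible finite components from ★ p861944 §1 at a ONE-DIMENSIONAL `P` (`R(f)|_P` has finite-dimensional domain, hence is compact — `exists_irreducible_admissible_hasFinComponent_of_finiteDimensional`,
  no «AFA»), the constituent pin by ★ `smoothConstituents_iff_of_hasFinComponent`; and **`boxChar (chiOneOfOneDim ξ v) _ (piTwoOfOneDim ξ v) ∈ (𝔩 v).memH ((rhoXi h8 ξ).loc v)`**
  (★ `boxChar_eq_mk_xiLocalChar` + ★ `memH_rhoXi_loc`); UNIQUENESS of the realising pair of `ξ`'s packet (★ `IrrClass.boxChar_eq_boxChar_iff`).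
* §3 THE DISCHARGE AT THE RECORD'S SHAPE (`archH` a parameter): `isRealisedH_shape_rhoXi` = the body of `IsRealisedH 𝔩 μ₂ μ₁ (rhoXi h8 ξ) (piTwoOfOneDim ξ) (chiOneOfOneDim ξ) _`;
  **`discH_shape_rhoXi`** = the body of `discHOfRecord 𝔩 𝔞H μ₂ μ₁ archH (rhoXi h8 ξ) (archH (piTwoOfOneDim ξ) (chiOneOfOneDim ξ))`; **`eq_archH_of_discH_shape`**: conversely ANY `P` with
  `discHOfRecord … (rhoXi h8 ξ) P` IS `archH (piTwoOfOneDim ξ) (chiOneOfOneDim ξ)` (uniqueness §2) — so at the record `IsOneDimH ρ ↔ ∃ ξ, ρ = packetHOfOneDim ξ` with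
  `packetHOfOneDim ξ := spectralPacketHOfOneDim h8 ξ (archH (piTwoOfOneDim ξ) (chiOneOfOneDim ξ)) (hunr ξ) (discH_shape_rhoXi …)` (C ED. 5, binders EXACTLY `h8` + `hunr`).

HONEST LABEL: nothing here closes S5#2∕S5#4; REL ≠ ★ ≠ BUILT; HC_CM is proved only modulo the 7 printed citations (2 remaining named inputs: hLiu418 = stmt-HodgeConjecture-24832,
h413 = stmt-HodgeConjecture-24833) until rung 0 closes.

## References
* [Rogawski1990] J. D. Rogawski, *Automorphic Representations of Unitary Groups in Three Variables*, Ann. of Math. Stud. 123 (1990), §12.1 p. 171 (type (3)); §13.1 p. 199; §13.3 pp. 202–203.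
* [BorelJacquet1979] A. Borel, H. Jacquet, *Automorphic forms and automorphic representations*, PSPM 33.1 (1979), §4.6.
* [Gelbart1975] S. Gelbart, *Automorphic forms on adele groups*, Ann. of Math. Stud. 83 (1975), §2.A.
* [FlathCorvallis1979] D. Flath, *Decomposition of representations into tensor products*, PSPM 33.1 (1979), Thm. 3.
* [BushnellHenniart2006] C. J. Bushnell, G. Henniart, *The Local Langlands Conjecture for GL(2)* (2006), §1.1, §9.1.
-/

set_option autoImplicit false
-- the mandated namespace repeats the single-problem summit's segment (`HodgeConjecture.HodgeConjecture`), as in every sibling `R90S5*` file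
set_option linter.dupNamespace false

noncomputable section

open NumberField IsDedekindDomain MeasureTheory Filter
open scoped Matrix
open Literature.NumberTheory Literature.NumberTheory.Automorphic Literature.NumberTheory.Automorphic.UnitaryGroup
open Literature.NumberTheory.Rogawski1990 Literature.NumberTheory.GaloisRepresentations
open Summit.HodgeConjecture.HodgeConjecture.Cruxes.H413
open Summit.HodgeConjecture.HodgeConjecture.Cruxes.H413.F0P3LocalPacketKit
open Summit.HodgeConjecture.HodgeConjecture.Cruxes.H413.F0P3GlobalPacket
open Summit.HodgeConjecture.HodgeConjecture.Cruxes.H413.F0P3GlobalPacketDiscrete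
open Summit.HodgeConjecture.HodgeConjecture.Cruxes.H413.F0P3ArchPacketKit
open Summit.HodgeConjecture.HodgeConjecture.Cruxes.H413.F0P3SpectralPacket
open Summit.HodgeConjecture.HodgeConjecture.Cruxes.H413.F0P3cPKtupleHSideLetters (Realises₂ Realises₁ IsFinConstituentAt₂ IsFinConstituentAt₁)
open Summit.HodgeConjecture.HodgeConjecture.Cruxes.H413.F0P3cPKtupleU1Line (realises₂_ofChar realises₁_ofChar isAutomorphic_eta_mul_psi)

namespace Summit.HodgeConjecture.HodgeConjecture.R90.S5

variable {L : Type} [Field L] [NumberField L] [IsCMField L] {H' : Matrix (Fin 3) (Fin 3) L}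
  {𝔩 : ∀ v : HeightOneSpectrum (𝓞 ↥(maximalRealSubfield L)), LocalPacketKit L H' v} {𝔞 : ArchPacketKit} {𝔞H : ArchPacketKitH 𝔞}
  {DiscH : GlobalPacketH 𝔩 → 𝔞H.PktInfH → Prop}

/-! ## §1 The constructor and `IsOneDimH` [§12.1 type (3); §13.1 p. 199; §13.3 p. 203] -/

/-- **`spectralPacketHOfOneDim h8 ξ Pinf hunr hdisc` — THE SPECTRAL `H`-PACKET OF THE ONE-DIMENSIONAL AUTOMORPHIC `ξ`**: finite part the singleton packet family `{⟦ξ_v⟧}_v`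
(★ `GlobalPacketH.rhoXi h8 ξ`, under the kit law (ℓ8) `OneDimHLaw` «one-dimensional representations of `H_v` are L-packets of cardinality one»), archimedean packet `Pinf`
(a parameter of the abstract datum `𝔞H`), cofinite unramifiedness of `ξ_H(ξ_v)` (`hunr`, a fact about the kit's data), and the discreteness witness `hdisc : DiscH (rhoXi h8 ξ) Pinf`.
[cite: Rogawski1990, §12.1 p. 171; §13.1 p. 199; §13.3 p. 203] -/
def spectralPacketHOfOneDim (h8 : ∀ v : HeightOneSpectrum (𝓞 ↥(maximalRealSubfield L)), (𝔩 v).OneDimHLaw) (ξ : OneDimAutRepH L) (Pinf : 𝔞H.PktInfH)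
    (hunr : ∀ᶠ v : HeightOneSpectrum (𝓞 ↥(maximalRealSubfield L)) in cofinite, (𝔩 v).unr ((𝔩 v).xiH ((GlobalPacketH.rhoXi h8 ξ).loc v)))
    (hdisc : DiscH (GlobalPacketH.rhoXi h8 ξ) Pinf) : SpectralPacketH 𝔩 𝔞 𝔞H DiscH :=
  ⟨GlobalPacketH.rhoXi h8 ξ, Pinf, hunr, hdisc⟩

/-- The finite part of `spectralPacketHOfOneDim` is `rhoXi h8 ξ` (`rfl`). [cite: Rogawski1990, §13.1 p. 199] -/
@[simp] theorem spectralPacketHOfOneDim_fin (h8 : ∀ v : HeightOneSpectrum (𝓞 ↥(maximalRealSubfield L)), (𝔩 v).OneDimHLaw) (ξ : OneDimAutRepH L) (Pinf : 𝔞H.PktInfH)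
    (hunr : ∀ᶠ v : HeightOneSpectrum (𝓞 ↥(maximalRealSubfield L)) in cofinite, (𝔩 v).unr ((𝔩 v).xiH ((GlobalPacketH.rhoXi h8 ξ).loc v)))
    (hdisc : DiscH (GlobalPacketH.rhoXi h8 ξ) Pinf) : (spectralPacketHOfOneDim h8 ξ Pinf hunr hdisc).fin = GlobalPacketH.rhoXi h8 ξ :=
  rfl

/-- The archimedean packet of `spectralPacketHOfOneDim` is the given `Pinf` (`rfl`). [cite: Rogawski1990, §12.1 p. 171] -/
@[simp] theorem spectralPacketHOfOneDim_inf (h8 : ∀ v : HeightOneSpectrum (𝓞 ↥(maximalRealSubfield L)), (𝔩 v).OneDimHLaw) (ξ : OneDimAutRepH L) (Pinf : 𝔞H.PktInfH)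
    (hunr : ∀ᶠ v : HeightOneSpectrum (𝓞 ↥(maximalRealSubfield L)) in cofinite, (𝔩 v).unr ((𝔩 v).xiH ((GlobalPacketH.rhoXi h8 ξ).loc v)))
    (hdisc : DiscH (GlobalPacketH.rhoXi h8 ξ) Pinf) : (spectralPacketHOfOneDim h8 ξ Pinf hunr hdisc).inf = Pinf :=
  rfl

/-- The member set of `(spectralPacketHOfOneDim …)_v` is the singleton `{⟦ξ_v⟧}` (★ `memH_rhoXi_loc`). [cite: Rogawski1990, §12.1 p. 171; §13.1 p. 199] -/
theorem memH_spectralPacketHOfOneDim_fin_loc (h8 : ∀ v : HeightOneSpectrum (𝓞 ↥(maximalRealSubfield L)), (𝔩 v).OneDimHLaw) (ξ : OneDimAutRepH L) (Pinf : 𝔞H.PktInfH)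
    (hunr : ∀ᶠ v : HeightOneSpectrum (𝓞 ↥(maximalRealSubfield L)) in cofinite, (𝔩 v).unr ((𝔩 v).xiH ((GlobalPacketH.rhoXi h8 ξ).loc v)))
    (hdisc : DiscH (GlobalPacketH.rhoXi h8 ξ) Pinf) (v : HeightOneSpectrum (𝓞 ↥(maximalRealSubfield L))) :
    (𝔩 v).memH ((spectralPacketHOfOneDim h8 ξ Pinf hunr hdisc).fin.loc v) =
      {IrrClass.mk (SmoothIrrep.ofChar (ξ.xiLocalChar v) (F0P3XiLocalCharOpenKernel.isOpen_ker_xiLocalChar L ξ v))} :=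
  GlobalPacketH.memH_rhoXi_loc h8 ξ v

/-- **The unramifiedness binder in IMAGE form**: if a `G`-side global packet `Pg` IS `ξ_H(rhoXi h8 ξ)` placewise (★ `GlobalPacket.IsImageOf`), its own cofinite-unramified clause gives
`hunr` (the pattern of ★ `F0P3SpectralPacketNValueOfRigidityH` :196). [cite: Rogawski1990, §13.1 p. 199; §13.3 p. 203 ¶2] -/
theorem eventually_unr_xiH_rhoXi_of_isImageOf (h8 : ∀ v : HeightOneSpectrum (𝓞 ↥(maximalRealSubfield L)), (𝔩 v).OneDimHLaw) (ξ : OneDimAutRepH L)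
    (Pg : GlobalPacket 𝔩) (himg : Pg.IsImageOf (GlobalPacketH.rhoXi h8 ξ)) :
    ∀ᶠ v : HeightOneSpectrum (𝓞 ↥(maximalRealSubfield L)) in cofinite, (𝔩 v).unr ((𝔩 v).xiH ((GlobalPacketH.rhoXi h8 ξ).loc v)) :=
  Pg.cofinite_unr.mono fun v hv => by rw [himg v]; exact hv

/-- **`spectralPacketHOfOneDimOfImage`** — the constructor with the unramifiedness binder in IMAGE form. [cite: Rogawski1990, §13.1 p. 199; §13.3 p. 203 ¶2] -/
def spectralPacketHOfOneDimOfImage (h8 : ∀ v : HeightOneSpectrum (𝓞 ↥(maximalRealSubfield L)), (𝔩 v).OneDimHLaw) (ξ : OneDimAutRepH L) (Pinf : 𝔞H.PktInfH)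
    (Pg : GlobalPacket 𝔩) (himg : Pg.IsImageOf (GlobalPacketH.rhoXi h8 ξ)) (hdisc : DiscH (GlobalPacketH.rhoXi h8 ξ) Pinf) : SpectralPacketH 𝔩 𝔞 𝔞H DiscH :=
  spectralPacketHOfOneDim h8 ξ Pinf (eventually_unr_xiH_rhoXi_of_isImageOf h8 ξ Pg himg) hdisc

/-- `spectralPacketHOfOneDimOfImage` is `spectralPacketHOfOneDim` at the derived `hunr` (`rfl`). [cite: Rogawski1990, §13.1 p. 199] -/
theorem spectralPacketHOfOneDimOfImage_eq (h8 : ∀ v : HeightOneSpectrum (𝓞 ↥(maximalRealSubfield L)), (𝔩 v).OneDimHLaw) (ξ : OneDimAutRepH L) (Pinf : 𝔞H.PktInfH)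
    (Pg : GlobalPacket 𝔩) (himg : Pg.IsImageOf (GlobalPacketH.rhoXi h8 ξ)) (hdisc : DiscH (GlobalPacketH.rhoXi h8 ξ) Pinf) :
    spectralPacketHOfOneDimOfImage h8 ξ Pinf Pg himg hdisc = spectralPacketHOfOneDim h8 ξ Pinf (eventually_unr_xiH_rhoXi_of_isImageOf h8 ξ Pg himg) hdisc :=
  rfl

/-- **`IsOneDimH ρ` — «THE SPECTRAL `H`-PACKET `ρ` IS (THE PACKET OF) A ONE-DIMENSIONAL AUTOMORPHIC `ξ`»**: its local packets are the singletons `{⟦ξ_v⟧}` for some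
`ξ : OneDimAutRepH L` (★ `GlobalPacketH.IsCharPacket` at `χ v := ξ.xiLocalChar v` — kit-law-free; the first conjunct of the letter ★ `XiHPacketsSigned`).  Print: the
`ρ ∈ Π(H)` with `dim ρ = 1` of Thm. 13.3.6 (c) ∕ p. 203. [cite: Rogawski1990, §13.3 pp. 202–203; §12.1 p. 171] -/
def IsOneDimH (ρ : SpectralPacketH 𝔩 𝔞 𝔞H DiscH) : Prop :=
  ∃ ξ : OneDimAutRepH L, ρ.fin.IsCharPacket (fun v => ξ.xiLocalChar v) (fun v => F0P3XiLocalCharOpenKernel.isOpen_ker_xiLocalChar L ξ v)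

/-- Unfolding of `IsOneDimH`. [cite: Rogawski1990, §13.3 p. 203] -/
theorem isOneDimH_iff (ρ : SpectralPacketH 𝔩 𝔞 𝔞H DiscH) :
    IsOneDimH ρ ↔ ∃ ξ : OneDimAutRepH L, ρ.fin.IsCharPacket (fun v => ξ.xiLocalChar v) (fun v => F0P3XiLocalCharOpenKernel.isOpen_ker_xiLocalChar L ξ v) :=
  Iff.rfl

/-- **Under (ℓ8): `IsOneDimH ρ ↔ ∃ ξ, ρ.fin = rhoXi h8 ξ`** (★ `eq_rhoXi_of_isCharPacket` ∕ ★ `rhoXi_isCharPacket`). [cite: Rogawski1990, §12.1 p. 171; §13.1 p. 199] -/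
theorem isOneDimH_iff_exists_fin_eq_rhoXi (h8 : ∀ v : HeightOneSpectrum (𝓞 ↥(maximalRealSubfield L)), (𝔩 v).OneDimHLaw) (ρ : SpectralPacketH 𝔩 𝔞 𝔞H DiscH) :
    IsOneDimH ρ ↔ ∃ ξ : OneDimAutRepH L, ρ.fin = GlobalPacketH.rhoXi h8 ξ :=
  ⟨fun ⟨ξ, hξ⟩ => ⟨ξ, GlobalPacketH.eq_rhoXi_of_isCharPacket h8 ξ hξ⟩, fun ⟨ξ, hξ⟩ => ⟨ξ, hξ ▸ GlobalPacketH.rhoXi_isCharPacket h8 ξ⟩⟩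

/-- **The dealer's shape: `IsOneDimH ρ ↔ ∃ ξ hunr hdisc, ρ = spectralPacketHOfOneDim h8 ξ ρ.inf hunr hdisc`** (the archimedean slot is `ρ`'s own; the two proof fields are
determined). [cite: Rogawski1990, §13.3 p. 203] -/
theorem isOneDimH_iff_exists_eq_spectralPacketHOfOneDim (h8 : ∀ v : HeightOneSpectrum (𝓞 ↥(maximalRealSubfield L)), (𝔩 v).OneDimHLaw)
    (ρ : SpectralPacketH 𝔩 𝔞 𝔞H DiscH) :
    IsOneDimH ρ ↔ ∃ (ξ : OneDimAutRepH L)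
      (hunr : ∀ᶠ v : HeightOneSpectrum (𝓞 ↥(maximalRealSubfield L)) in cofinite, (𝔩 v).unr ((𝔩 v).xiH ((GlobalPacketH.rhoXi h8 ξ).loc v)))
      (hdisc : DiscH (GlobalPacketH.rhoXi h8 ξ) ρ.inf), ρ = spectralPacketHOfOneDim h8 ξ ρ.inf hunr hdisc := by
  rw [isOneDimH_iff_exists_fin_eq_rhoXi h8]
  constructor
  · rintro ⟨ξ, hξ⟩
    obtain ⟨fin, inf, hcof, hd⟩ := ρ
    subst hξ
    exact ⟨ξ, hcof, hd, rfl⟩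
  · rintro ⟨ξ, hunr, hdisc, h⟩
    exact ⟨ξ, by rw [h]; rfl⟩

/-- `spectralPacketHOfOneDim h8 ξ …` is one-dimensional in the sense of `IsOneDimH`. [cite: Rogawski1990, §13.3 p. 203] -/
theorem isOneDimH_spectralPacketHOfOneDim (h8 : ∀ v : HeightOneSpectrum (𝓞 ↥(maximalRealSubfield L)), (𝔩 v).OneDimHLaw) (ξ : OneDimAutRepH L) (Pinf : 𝔞H.PktInfH)
    (hunr : ∀ᶠ v : HeightOneSpectrum (𝓞 ↥(maximalRealSubfield L)) in cofinite, (𝔩 v).unr ((𝔩 v).xiH ((GlobalPacketH.rhoXi h8 ξ).loc v)))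
    (hdisc : DiscH (GlobalPacketH.rhoXi h8 ξ) Pinf) : IsOneDimH (spectralPacketHOfOneDim h8 ξ Pinf hunr hdisc) :=
  ⟨ξ, GlobalPacketH.rhoXi_isCharPacket h8 ξ⟩

/-- A one-dimensional `ρ` has singleton local packets `{⟦ξ_v⟧}`. [cite: Rogawski1990, §12.1 p. 171] -/
theorem IsOneDimH.exists_memH_eq_singleton {ρ : SpectralPacketH 𝔩 𝔞 𝔞H DiscH} (h : IsOneDimH ρ) :
    ∃ ξ : OneDimAutRepH L, ∀ v : HeightOneSpectrum (𝓞 ↥(maximalRealSubfield L)),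
      (𝔩 v).memH (ρ.fin.loc v) = {IrrClass.mk (SmoothIrrep.ofChar (ξ.xiLocalChar v) (F0P3XiLocalCharOpenKernel.isOpen_ker_xiLocalChar L ξ v))} :=
  h

end Summit.HodgeConjecture.HodgeConjecture.R90.S5

/-! ## §2 The explicit realising pair of `ξ` and the two character lines [§13.3 pp. 202–203; BorelJacquet1979 §4.6] -/

namespace Summit.HodgeConjecture.HodgeConjecture.R90.S5

section Generic

variable {F E : Type} [Field F] [NumberField F] [Field E] [NumberField E] [Algebra F E] {c : E ≃ₐ[F] E} {N : ℕ} {J : Matrix (Fin N) (Fin N) E}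
  {μ : Measure (adelicGroupData F E c N J).automorphicQuotient} [(adelicGroupData F E c N J).IsAutomorphicMeasure μ]

/-- **A FINITE-DIMENSIONAL DISCRETE `P` HAS AN IRREDUCIBLE ADMISSIBLE FINITE COMPONENT — no «AFA»**: `R(f)|_P` has a finite-dimensional (hence locally compact) domain, so it is a
compact operator (Mathlib `isCompactOperator_of_locallyCompactSpace_rng`), and ★ p861944 `exists_irreducible_admissible_hasFinComponent_of_isCompactOperator` applies.  The case of
record: the one-dimensional character lines ★ `DiscreteAutomorphicRep.ofChar ψ μ`. [cite: BorelJacquet1979, §4.6] [cite: FlathCorvallis1979, Thm. 3] -/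
theorem exists_irreducible_admissible_hasFinComponent_of_finiteDimensional (P : DiscreteAutomorphicRep (adelicGroupData F E c N J) μ)
    [FiniteDimensional ℂ P.space.toSubmodule] :
    ∃ (W : Type) (_ : AddCommGroup W) (_ : Module ℂ W) (σ : Representation ℂ (finAdelic F E c N J) W),
      σ.IsIrreducible ∧ σ.IsAdmissible ∧ P.HasFinComponent σ := by
  refine exists_irreducible_admissible_hasFinComponent_of_isCompactOperator P ?_
  intro _ _ ν _ f
  haveI : ProperSpace P.space.toSubmodule := FiniteDimensional.proper_rclike ℂ P.space.toSubmodule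
  exact isCompactOperator_of_locallyCompactSpace_rng
    ((((adelicGroupData F E c N J).rightRegular μ).integratedOperator ((adelicGroupData F E c N J).isUnitary_rightRegular μ)
      ((adelicGroupData F E c N J).isStronglyContinuous_rightRegular_holds μ) ν f).comp P.space.toSubmodule.subtypeL)

/-- The character line `ofChar ψ μ` is finite-dimensional (one-dimensional, ★ `isOneDimensional_ofChar`). [cite: Gelbart1975, §2.A] -/
theorem finiteDimensional_ofChar_space (ψ : (adelicGroupData F E c N J).AutomorphicCharacter) :
    FiniteDimensional ℂ (DiscreteAutomorphicRep.ofChar ψ μ).space.toSubmodule :=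
  Module.finite_of_finrank_eq_succ (DiscreteAutomorphicRep.isOneDimensional_ofChar ψ μ)

/-- **THE CHARACTER LINE `ofChar ψ μ` HAS AN IRREDUCIBLE ADMISSIBLE FINITE COMPONENT** (letter-free). [cite: BorelJacquet1979, §4.6] [cite: Gelbart1975, §2.A] -/
theorem exists_irreducible_admissible_hasFinComponent_ofChar (ψ : (adelicGroupData F E c N J).AutomorphicCharacter) :
    ∃ (W : Type) (_ : AddCommGroup W) (_ : Module ℂ W) (σ : Representation ℂ (finAdelic F E c N J) W),
      σ.IsIrreducible ∧ σ.IsAdmissible ∧ (DiscreteAutomorphicRep.ofChar ψ μ).HasFinComponent σ := by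
  haveI := finiteDimensional_ofChar_space (μ := μ) ψ
  exact exists_irreducible_admissible_hasFinComponent_of_finiteDimensional _

end Generic

section CM

variable {L : Type} [Field L] [NumberField L] [IsCMField L]

/-- **`piTwoOfOneDim ξ v := ⟦ℂ_{ξ_v ∘ inl}⟧`** — the class of the one-dimensional smooth representation `(η_v ψ_v) ∘ det₀` of `U(Φ₂)(L⁺_v)` (★ `SmoothIrrep.ofChar`; ★ `xiLocalChar_comp_inl`):
the `U(Φ₂)`-component of `ξ_v = ((η ψ) ∘ det₀) ⊠ ψ`. [cite: Rogawski1990, §13.3 p. 202; §12.1 p. 171] -/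
def piTwoOfOneDim (ξ : OneDimAutRepH L) (v : HeightOneSpectrum (𝓞 ↥(maximalRealSubfield L))) :
    IrrClass ((cmDatum L 2 (Matrix.of fun i j : Fin 2 => if i.val + j.val + 1 = 2 then (1 : L) else 0)).Local v) :=
  IrrClass.mk (SmoothIrrep.ofChar ((ξ.xiLocalChar v).comp (MonoidHom.inl _ _))
    (IrrClass.isOpen_ker_comp_inl (F0P3XiLocalCharOpenKernel.isOpen_ker_xiLocalChar L ξ v)))

/-- **`chiOneOfOneDim ξ v := ξ_v ∘ inr = ψ_v ∘ det`** — the `U(Φ₁)`-component character of `ξ_v` (★ `xiLocalChar_comp_inr`). [cite: Rogawski1990, §13.3 p. 202; §12.1 p. 171] -/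
def chiOneOfOneDim (ξ : OneDimAutRepH L) (v : HeightOneSpectrum (𝓞 ↥(maximalRealSubfield L))) :
    (cmDatum L 1 (Matrix.of fun i j : Fin 1 => if i.val + j.val + 1 = 1 then (1 : L) else 0)).Local v →* ℂˣ :=
  (ξ.xiLocalChar v).comp (MonoidHom.inr _ _)

/-- `chiOneOfOneDim ξ v` has open kernel (★ `IrrClass.isOpen_ker_comp_inr` of ★ `isOpen_ker_xiLocalChar`). [cite: BushnellHenniart2006, §1.1] -/
theorem isOpen_ker_chiOneOfOneDim (ξ : OneDimAutRepH L) (v : HeightOneSpectrum (𝓞 ↥(maximalRealSubfield L))) :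
    IsOpen ((((chiOneOfOneDim ξ v).ker : Subgroup ((cmDatum L 1 (Matrix.of fun i j : Fin 1 => if i.val + j.val + 1 = 1 then (1 : L) else 0)).Local v))) :
      Set ((cmDatum L 1 (Matrix.of fun i j : Fin 1 => if i.val + j.val + 1 = 1 then (1 : L) else 0)).Local v)) :=
  IrrClass.isOpen_ker_comp_inr (F0P3XiLocalCharOpenKernel.isOpen_ker_xiLocalChar L ξ v)

/-- Unfolding of `piTwoOfOneDim`. [cite: Rogawski1990, §12.1 p. 171] -/
theorem piTwoOfOneDim_eq (ξ : OneDimAutRepH L) (v : HeightOneSpectrum (𝓞 ↥(maximalRealSubfield L))) :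
    piTwoOfOneDim ξ v = IrrClass.mk (SmoothIrrep.ofChar ((ξ.xiLocalChar v).comp (MonoidHom.inl _ _))
      (IrrClass.isOpen_ker_comp_inl (F0P3XiLocalCharOpenKernel.isOpen_ker_xiLocalChar L ξ v))) :=
  rfl

/-- Unfolding of `chiOneOfOneDim`. [cite: Rogawski1990, §12.1 p. 171] -/
theorem chiOneOfOneDim_eq (ξ : OneDimAutRepH L) (v : HeightOneSpectrum (𝓞 ↥(maximalRealSubfield L))) :
    chiOneOfOneDim ξ v = (ξ.xiLocalChar v).comp (MonoidHom.inr _ _) :=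
  rfl

/-- **`⟦piTwoOfOneDim ξ v⟧ ⊠ chiOneOfOneDim ξ v = ⟦ξ_v⟧`** (★ `boxChar_eq_mk_xiLocalChar`). [cite: Rogawski1990, §12.1 p. 171] [cite: BushnellHenniart2006, §9.1] -/
theorem boxChar_chiOneOfOneDim_piTwoOfOneDim (ξ : OneDimAutRepH L) (v : HeightOneSpectrum (𝓞 ↥(maximalRealSubfield L))) :
    IrrClass.boxChar (chiOneOfOneDim ξ v) (isOpen_ker_chiOneOfOneDim ξ v) (piTwoOfOneDim ξ v) =
      IrrClass.mk (SmoothIrrep.ofChar (ξ.xiLocalChar v) (F0P3XiLocalCharOpenKernel.isOpen_ker_xiLocalChar L ξ v)) :=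
  F0P3cPKtupleKR2OfKD4H.boxChar_eq_mk_xiLocalChar ξ v (isOpen_ker_chiOneOfOneDim ξ v) rfl rfl

variable {H' : Matrix (Fin 3) (Fin 3) L} {𝔩 : ∀ v : HeightOneSpectrum (𝓞 ↥(maximalRealSubfield L)), LocalPacketKit L H' v}

/-- **`⟦piTwoOfOneDim ξ v⟧ ⊠ chiOneOfOneDim ξ v ∈ (rhoXi h8 ξ)_v = {⟦ξ_v⟧}`** — the membership clause of S5-C's `IsRealisedH` at `ξ`'s packet (★ `memH_rhoXi_loc`).
[cite: Rogawski1990, §13.3 p. 202; §12.1 p. 171] -/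
theorem boxChar_chiOneOfOneDim_piTwoOfOneDim_mem_memH_rhoXi (h8 : ∀ v : HeightOneSpectrum (𝓞 ↥(maximalRealSubfield L)), (𝔩 v).OneDimHLaw) (ξ : OneDimAutRepH L)
    (v : HeightOneSpectrum (𝓞 ↥(maximalRealSubfield L))) :
    IrrClass.boxChar (chiOneOfOneDim ξ v) (isOpen_ker_chiOneOfOneDim ξ v) (piTwoOfOneDim ξ v) ∈ (𝔩 v).memH ((GlobalPacketH.rhoXi h8 ξ).loc v) := by
  rw [GlobalPacketH.memH_rhoXi_loc h8 ξ v, boxChar_chiOneOfOneDim_piTwoOfOneDim, Finset.mem_singleton]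

/-- **UNIQUENESS OF THE REALISING PAIR**: if `π₂,v ⊠ χ₁,v ∈ (rhoXi h8 ξ)_v = {⟦ξ_v⟧}` at every `v`, then `π₂ = piTwoOfOneDim ξ` and `χ₁ = chiOneOfOneDim ξ` (★ `IrrClass.boxChar_eq_boxChar_iff`:
`⊠` is injective on classes AND characters). [cite: Rogawski1990, §12.1 p. 171] [cite: BushnellHenniart2006, §9.1] -/
theorem eq_piTwoOfOneDim_and_eq_chiOneOfOneDim_of_boxChar_mem (h8 : ∀ v : HeightOneSpectrum (𝓞 ↥(maximalRealSubfield L)), (𝔩 v).OneDimHLaw) (ξ : OneDimAutRepH L)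
    {π₂ : ∀ v : HeightOneSpectrum (𝓞 ↥(maximalRealSubfield L)), IrrClass ((cmDatum L 2 (Matrix.of fun i j : Fin 2 => if i.val + j.val + 1 = 2 then (1 : L) else 0)).Local v)}
    {χ₁ : ∀ v : HeightOneSpectrum (𝓞 ↥(maximalRealSubfield L)), ((cmDatum L 1 (Matrix.of fun i j : Fin 1 => if i.val + j.val + 1 = 1 then (1 : L) else 0)).Local v) →* ℂˣ}
    {hχ₁ : ∀ v : HeightOneSpectrum (𝓞 ↥(maximalRealSubfield L)),
      IsOpen (((χ₁ v).ker : Subgroup ((cmDatum L 1 (Matrix.of fun i j : Fin 1 => if i.val + j.val + 1 = 1 then (1 : L) else 0)).Local v)) :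
        Set ((cmDatum L 1 (Matrix.of fun i j : Fin 1 => if i.val + j.val + 1 = 1 then (1 : L) else 0)).Local v))}
    (hmem : ∀ v : HeightOneSpectrum (𝓞 ↥(maximalRealSubfield L)), IrrClass.boxChar (χ₁ v) (hχ₁ v) (π₂ v) ∈ (𝔩 v).memH ((GlobalPacketH.rhoXi h8 ξ).loc v)) :
    π₂ = piTwoOfOneDim ξ ∧ χ₁ = chiOneOfOneDim ξ := by
  have key : ∀ v : HeightOneSpectrum (𝓞 ↥(maximalRealSubfield L)), π₂ v = piTwoOfOneDim ξ v ∧ χ₁ v = chiOneOfOneDim ξ v := fun v => by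
    have h := hmem v
    rw [GlobalPacketH.memH_rhoXi_loc h8 ξ v, Finset.mem_singleton, ← boxChar_chiOneOfOneDim_piTwoOfOneDim ξ v] at h
    exact (IrrClass.boxChar_eq_boxChar_iff (hχ₁ v) (isOpen_ker_chiOneOfOneDim ξ v)).1 h
  exact ⟨funext fun v => (key v).1, funext fun v => (key v).2⟩

/-- **THE CHARACTER LINE `ℂ · ((η ψ) ∘ det₀)⁻¹` OF `L²_disc(U(Φ₂), μ₂)` OCCURS WITH FINITE LOCAL COMPONENTS `piTwoOfOneDim ξ`**, for EVERY automorphic measure `μ₂`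
(★ `cmOccursInDiscreteSpectrum L 2 Φ₂ μ₂ (piTwoOfOneDim ξ)` — the first clause of S5-C's `IsRealisedH` at `ξ`).  Witness: `P₂ := ofChar (cmDetChar L 2 Φ₂ (η ψ) …)⁻¹ μ₂` (★ `realises₂_ofChar`:
its finite constituents at `v` are exactly `⟦ℂ_{ξ_v ∘ inl}⟧`), its irreducible admissible finite component from `exists_irreducible_admissible_hasFinComponent_ofChar`, the pin along
★ `exists_cmOccursInDiscreteSpectrum_of_hasFinComponent` + ★ `smoothConstituents_iff_of_hasFinComponent`. [cite: Rogawski1990, §13.3 pp. 202–203] [cite: BorelJacquet1979, §4.6] [cite: Gelbart1975, §2.A] -/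
theorem cmOccursInDiscreteSpectrum_piTwoOfOneDim
    (μ₂ : Measure (adelicGroupData (↥(maximalRealSubfield L)) L (IsCMField.complexConj L) 2 (Matrix.of fun i j : Fin 2 => if i.val + j.val + 1 = 2 then (1 : L) else 0)).automorphicQuotient)
    [(adelicGroupData (↥(maximalRealSubfield L)) L (IsCMField.complexConj L) 2 (Matrix.of fun i j : Fin 2 => if i.val + j.val + 1 = 2 then (1 : L) else 0)).IsAutomorphicMeasure μ₂]
    (ξ : OneDimAutRepH L) :
    cmOccursInDiscreteSpectrum L 2 (Matrix.of fun i j : Fin 2 => if i.val + j.val + 1 = 2 then (1 : L) else 0) μ₂ (piTwoOfOneDim ξ) := by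
  set P₂ := DiscreteAutomorphicRep.ofChar (cmDetChar L 2 (Matrix.of fun i j : Fin 2 => if i.val + j.val + 1 = 2 then (1 : L) else 0) (ξ.η * ξ.ψ)
    (isAutomorphic_eta_mul_psi ξ) (isUnit_antidiagOne_det L 2).ne_zero)⁻¹ μ₂ with hP₂
  have hreal : Realises₂ P₂ ξ := realises₂_ofChar ξ
  obtain ⟨W, _, _, σ, hirr, hadm, hP⟩ := exists_irreducible_admissible_hasFinComponent_ofChar (μ := μ₂)
    (cmDetChar L 2 (Matrix.of fun i j : Fin 2 => if i.val + j.val + 1 = 2 then (1 : L) else 0) (ξ.η * ξ.ψ) (isAutomorphic_eta_mul_psi ξ) (isUnit_antidiagOne_det L 2).ne_zero)⁻¹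
  obtain ⟨π, hocc, hπ⟩ := exists_cmOccursInDiscreteSpectrum_of_hasFinComponent L 2 _ μ₂ P₂ hirr hadm hP
  have heq : π = piTwoOfOneDim ξ := by
    funext v
    refine ((hπ v (piTwoOfOneDim ξ v)).1 ?_).symm
    exact (F0P3FinPartConstituentTransfer.smoothConstituents_iff_of_hasFinComponent P₂ hirr hadm hP v _).1 ((hreal v (piTwoOfOneDim ξ v)).2 rfl)
  rw [← heq]
  exact hocc

/-- **THE `U(1)` LINE `ℂ · (ψ ∘ det)⁻¹` OF `L²(U(Φ₁), μ₁)` OCCURS WITH FINITE LOCAL COMPONENTS `⟦ℂ_{chiOneOfOneDim ξ v}⟧`**, for EVERY automorphic measure `μ₁` (the second clause of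
S5-C's `IsRealisedH` at `ξ`; ★ `realises₁_ofChar`). [cite: Rogawski1990, §13.3 pp. 202–203] [cite: Gelbart1975, §2.A] -/
theorem cmOccursInDiscreteSpectrum_chiOneOfOneDim
    (μ₁ : Measure (adelicGroupData (↥(maximalRealSubfield L)) L (IsCMField.complexConj L) 1 (Matrix.of fun i j : Fin 1 => if i.val + j.val + 1 = 1 then (1 : L) else 0)).automorphicQuotient)
    [(adelicGroupData (↥(maximalRealSubfield L)) L (IsCMField.complexConj L) 1 (Matrix.of fun i j : Fin 1 => if i.val + j.val + 1 = 1 then (1 : L) else 0)).IsAutomorphicMeasure μ₁]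
    (ξ : OneDimAutRepH L) :
    cmOccursInDiscreteSpectrum L 1 (Matrix.of fun i j : Fin 1 => if i.val + j.val + 1 = 1 then (1 : L) else 0) μ₁
      (fun v => IrrClass.mk (SmoothIrrep.ofChar (chiOneOfOneDim ξ v) (isOpen_ker_chiOneOfOneDim ξ v))) := by
  set P₁ := DiscreteAutomorphicRep.ofChar (cmDetChar L 1 (Matrix.of fun i j : Fin 1 => if i.val + j.val + 1 = 1 then (1 : L) else 0) ξ.ψ ξ.hψ
    (isUnit_antidiagOne_det L 1).ne_zero)⁻¹ μ₁ with hP₁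
  have hreal : Realises₁ P₁ ξ := realises₁_ofChar ξ
  obtain ⟨W, _, _, σ, hirr, hadm, hP⟩ := exists_irreducible_admissible_hasFinComponent_ofChar (μ := μ₁)
    (cmDetChar L 1 (Matrix.of fun i j : Fin 1 => if i.val + j.val + 1 = 1 then (1 : L) else 0) ξ.ψ ξ.hψ (isUnit_antidiagOne_det L 1).ne_zero)⁻¹
  obtain ⟨π, hocc, hπ⟩ := exists_cmOccursInDiscreteSpectrum_of_hasFinComponent L 1 _ μ₁ P₁ hirr hadm hP
  have heq : π = fun v => IrrClass.mk (SmoothIrrep.ofChar (chiOneOfOneDim ξ v) (isOpen_ker_chiOneOfOneDim ξ v)) := by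
    funext v
    refine ((hπ v _).1 ?_).symm
    exact (F0P3FinPartConstituentTransfer.smoothConstituents_iff_of_hasFinComponent P₁ hirr hadm hP v _).1 ((hreal v _).2 rfl)
  rw [← heq]
  exact hocc

/-! ## §3 The discharge at the record's shape (`IsRealisedH` ∕ `discHOfRecord` unfolded; `archH` a parameter) [§13.3 pp. 202–203] -/

variable
  (μ₂ : Measure (adelicGroupData (↥(maximalRealSubfield L)) L (IsCMField.complexConj L) 2 (Matrix.of fun i j : Fin 2 => if i.val + j.val + 1 = 2 then (1 : L) else 0)).automorphicQuotient)
  [(adelicGroupData (↥(maximalRealSubfield L)) L (IsCMField.complexConj L) 2 (Matrix.of fun i j : Fin 2 => if i.val + j.val + 1 = 2 then (1 : L) else 0)).IsAutomorphicMeasure μ₂]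
  (μ₁ : Measure (adelicGroupData (↥(maximalRealSubfield L)) L (IsCMField.complexConj L) 1 (Matrix.of fun i j : Fin 1 => if i.val + j.val + 1 = 1 then (1 : L) else 0)).automorphicQuotient)
  [(adelicGroupData (↥(maximalRealSubfield L)) L (IsCMField.complexConj L) 1 (Matrix.of fun i j : Fin 1 => if i.val + j.val + 1 = 1 then (1 : L) else 0)).IsAutomorphicMeasure μ₁]

/-- **`IsRealisedH 𝔩 μ₂ μ₁ (rhoXi h8 ξ) (piTwoOfOneDim ξ) (chiOneOfOneDim ξ) _` — ITS BODY, TOKEN FOR TOKEN** (S5-C :95): the pair `(piTwoOfOneDim ξ, chiOneOfOneDim ξ)` realises `ξ`'s packet in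
`L²_disc(U(Φ₂), μ₂) ⊗ L²_disc(U(Φ₁), μ₁)`. [cite: Rogawski1990, §13.3 pp. 202–203; §12.1 p. 171] -/
theorem isRealisedH_shape_rhoXi (h8 : ∀ v : HeightOneSpectrum (𝓞 ↥(maximalRealSubfield L)), (𝔩 v).OneDimHLaw) (ξ : OneDimAutRepH L) :
    cmOccursInDiscreteSpectrum L 2 (Matrix.of fun i j : Fin 2 => if i.val + j.val + 1 = 2 then (1 : L) else 0) μ₂ (piTwoOfOneDim ξ) ∧
      cmOccursInDiscreteSpectrum L 1 (Matrix.of fun i j : Fin 1 => if i.val + j.val + 1 = 1 then (1 : L) else 0) μ₁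
        (fun v => IrrClass.mk (SmoothIrrep.ofChar (chiOneOfOneDim ξ v) (isOpen_ker_chiOneOfOneDim ξ v))) ∧
      ∀ v : HeightOneSpectrum (𝓞 ↥(maximalRealSubfield L)),
        IrrClass.boxChar (chiOneOfOneDim ξ v) (isOpen_ker_chiOneOfOneDim ξ v) (piTwoOfOneDim ξ v) ∈ (𝔩 v).memH ((GlobalPacketH.rhoXi h8 ξ).loc v) :=
  ⟨cmOccursInDiscreteSpectrum_piTwoOfOneDim μ₂ ξ, cmOccursInDiscreteSpectrum_chiOneOfOneDim μ₁ ξ, boxChar_chiOneOfOneDim_piTwoOfOneDim_mem_memH_rhoXi h8 ξ⟩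

variable {𝔞 : ArchPacketKit} {𝔞H : ArchPacketKitH 𝔞}

/-- **`discHOfRecord 𝔩 𝔞H μ₂ μ₁ archH (rhoXi h8 ξ) (archH (piTwoOfOneDim ξ) (chiOneOfOneDim ξ))` — ITS BODY, TOKEN FOR TOKEN** (S5-C :112): `ξ`'s packet, with the archimedean packet
`archH` OF ITS OWN REALISING PAIR, is a DISCRETE `H`-packet of record.  This is the `hdisc` of C ED. 5's `packetHOfOneDim ξ := spectralPacketHOfOneDim h8 ξ (archH (piTwoOfOneDim ξ) (chiOneOfOneDim ξ)) (hunr ξ) ‹this›`.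
[cite: Rogawski1990, §13.3 pp. 202–203] -/
theorem discH_shape_rhoXi (h8 : ∀ v : HeightOneSpectrum (𝓞 ↥(maximalRealSubfield L)), (𝔩 v).OneDimHLaw)
    (archH : (∀ v : HeightOneSpectrum (𝓞 ↥(maximalRealSubfield L)), IrrClass ((cmDatum L 2 (Matrix.of fun i j : Fin 2 => if i.val + j.val + 1 = 2 then (1 : L) else 0)).Local v)) →
      (∀ v : HeightOneSpectrum (𝓞 ↥(maximalRealSubfield L)), ((cmDatum L 1 (Matrix.of fun i j : Fin 1 => if i.val + j.val + 1 = 1 then (1 : L) else 0)).Local v) →* ℂˣ) → 𝔞H.PktInfH)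
    (ξ : OneDimAutRepH L) :
    ∃ (π₂ : ∀ v : HeightOneSpectrum (𝓞 ↥(maximalRealSubfield L)), IrrClass ((cmDatum L 2 (Matrix.of fun i j : Fin 2 => if i.val + j.val + 1 = 2 then (1 : L) else 0)).Local v))
      (χ₁ : ∀ v : HeightOneSpectrum (𝓞 ↥(maximalRealSubfield L)), ((cmDatum L 1 (Matrix.of fun i j : Fin 1 => if i.val + j.val + 1 = 1 then (1 : L) else 0)).Local v) →* ℂˣ)
      (hχ₁ : ∀ v : HeightOneSpectrum (𝓞 ↥(maximalRealSubfield L)),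
        IsOpen (((χ₁ v).ker : Subgroup ((cmDatum L 1 (Matrix.of fun i j : Fin 1 => if i.val + j.val + 1 = 1 then (1 : L) else 0)).Local v)) :
          Set ((cmDatum L 1 (Matrix.of fun i j : Fin 1 => if i.val + j.val + 1 = 1 then (1 : L) else 0)).Local v))),
      (cmOccursInDiscreteSpectrum L 2 (Matrix.of fun i j : Fin 2 => if i.val + j.val + 1 = 2 then (1 : L) else 0) μ₂ π₂ ∧
        cmOccursInDiscreteSpectrum L 1 (Matrix.of fun i j : Fin 1 => if i.val + j.val + 1 = 1 then (1 : L) else 0) μ₁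
          (fun v => IrrClass.mk (SmoothIrrep.ofChar (χ₁ v) (hχ₁ v))) ∧
        ∀ v : HeightOneSpectrum (𝓞 ↥(maximalRealSubfield L)), IrrClass.boxChar (χ₁ v) (hχ₁ v) (π₂ v) ∈ (𝔩 v).memH ((GlobalPacketH.rhoXi h8 ξ).loc v)) ∧
      archH (piTwoOfOneDim ξ) (chiOneOfOneDim ξ) = archH π₂ χ₁ :=
  ⟨piTwoOfOneDim ξ, chiOneOfOneDim ξ, isOpen_ker_chiOneOfOneDim ξ, isRealisedH_shape_rhoXi μ₂ μ₁ h8 ξ, rfl⟩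

/-- **UNIQUENESS AT THE RECORD**: if `(rhoXi h8 ξ, P)` satisfies the body of `discHOfRecord 𝔩 𝔞H μ₂ μ₁ archH` for ANY realising pair, then `P = archH (piTwoOfOneDim ξ) (chiOneOfOneDim ξ)`
(the realising pair of a character packet is unique, §2) — whence at the record `IsOneDimH ρ ↔ ∃ ξ, ρ = packetHOfOneDim ξ`. [cite: Rogawski1990, §13.3 p. 203; §12.1 p. 171] -/
theorem eq_archH_of_discH_shape (h8 : ∀ v : HeightOneSpectrum (𝓞 ↥(maximalRealSubfield L)), (𝔩 v).OneDimHLaw)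
    (archH : (∀ v : HeightOneSpectrum (𝓞 ↥(maximalRealSubfield L)), IrrClass ((cmDatum L 2 (Matrix.of fun i j : Fin 2 => if i.val + j.val + 1 = 2 then (1 : L) else 0)).Local v)) →
      (∀ v : HeightOneSpectrum (𝓞 ↥(maximalRealSubfield L)), ((cmDatum L 1 (Matrix.of fun i j : Fin 1 => if i.val + j.val + 1 = 1 then (1 : L) else 0)).Local v) →* ℂˣ) → 𝔞H.PktInfH)
    (ξ : OneDimAutRepH L) {P : 𝔞H.PktInfH}
    (hP : ∃ (π₂ : ∀ v : HeightOneSpectrum (𝓞 ↥(maximalRealSubfield L)), IrrClass ((cmDatum L 2 (Matrix.of fun i j : Fin 2 => if i.val + j.val + 1 = 2 then (1 : L) else 0)).Local v))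
      (χ₁ : ∀ v : HeightOneSpectrum (𝓞 ↥(maximalRealSubfield L)), ((cmDatum L 1 (Matrix.of fun i j : Fin 1 => if i.val + j.val + 1 = 1 then (1 : L) else 0)).Local v) →* ℂˣ)
      (hχ₁ : ∀ v : HeightOneSpectrum (𝓞 ↥(maximalRealSubfield L)),
        IsOpen (((χ₁ v).ker : Subgroup ((cmDatum L 1 (Matrix.of fun i j : Fin 1 => if i.val + j.val + 1 = 1 then (1 : L) else 0)).Local v)) :
          Set ((cmDatum L 1 (Matrix.of fun i j : Fin 1 => if i.val + j.val + 1 = 1 then (1 : L) else 0)).Local v))),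
      (cmOccursInDiscreteSpectrum L 2 (Matrix.of fun i j : Fin 2 => if i.val + j.val + 1 = 2 then (1 : L) else 0) μ₂ π₂ ∧
        cmOccursInDiscreteSpectrum L 1 (Matrix.of fun i j : Fin 1 => if i.val + j.val + 1 = 1 then (1 : L) else 0) μ₁
          (fun v => IrrClass.mk (SmoothIrrep.ofChar (χ₁ v) (hχ₁ v))) ∧
        ∀ v : HeightOneSpectrum (𝓞 ↥(maximalRealSubfield L)), IrrClass.boxChar (χ₁ v) (hχ₁ v) (π₂ v) ∈ (𝔩 v).memH ((GlobalPacketH.rhoXi h8 ξ).loc v)) ∧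
      P = archH π₂ χ₁) :
    P = archH (piTwoOfOneDim ξ) (chiOneOfOneDim ξ) := by
  obtain ⟨π₂, χ₁, hχ₁, ⟨-, -, hmem⟩, hPe⟩ := hP
  obtain ⟨h₂, h₁⟩ := eq_piTwoOfOneDim_and_eq_chiOneOfOneDim_of_boxChar_mem h8 ξ hmem
  subst h₂ h₁
  exact hPe

end CM

end Summit.HodgeConjecture.HodgeConjecture.R90.S5

end
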